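import Summits.ResolutionOfSingularities.ResolutionOfSingularities.Theorems.FrobeniusClosingPatchingRelPerfectDepthWeightTwoBState
import Summits.ResolutionOfSingularities.ResolutionOfSingularities.Theorems.FrobeniusClosingPatchingRelPerfectDepthHostRegularTransport
import HarnessLib

/-!
# Crux `PatchingRelPerfect` (stmt-ResolutionOfSingularities-16161), chain W5.2 — F5c / TargetsF5c T5-E^nr «W₂B WITHOUT REDUCEDNESS»:
# the transport state `StateNr` = res-D-pv-054's `WeightTwoB.StateIn` WITHOUT the clause `hostRad`

[OURS · L1 W5.2 · TargetsF5c T5-E^nr (res-L1-w52-plan-1 STEER 4 2026-08-27T11:07:07Z; owner res-D-pv-052 AS res-L1-w52-stub-7).]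
Fact-free; NOT statements of the manuscript under review (Hironaka 2017); AI-written, weaker than expert review.

DESIGN «(J#) carries the invariant» (owner's cut 11:17:08Z). In res-D-pv-054's T5-E transport (`…DepthWeightTwoB*`, target
`WeightTwoBoundaryJR₃` with `IsReduced 𝔟.subscheme`) the reduced-host clause `StateIn.hostRad : D = vanishingIdeal D.support`
is CONSUMED at exactly two places — the permissibility clause of `CentreIn.transport` and `StateIn.endClauses` — while every
step datum (`m := ord_η D`, `D ≤ 𝓘(Z)^m`, `hostCartier'`, `support_host'`, `fac'`, `free'`, `joint'`, the deficient-point host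
lemma `exists_regular_host_generator`) is reducedness-free as landed.  Moreover the pointwise JOINT invariant (J#) «at every host
point on an N-charged member, `D :: charged` is snc» FORCES the host stalk there to be a regular parameter (`exponent one`), which
is plan-1's invariant «components of exponent ≥ 2 never meet N-charged members».  Hence the state of T5-E^nr is `StateIn` minus
`hostRad`, verbatim otherwise; the centre data `WeightTwoB.CentreIn` and the single-piece datum `WeightTwoB.PieceIn` are REUSED
by name (they never mentioned reducedness: `CentreIn.perm` / `PieceIn.perm` speak of `vanishingIdeal D.support`, the reduced
zero-scheme of the host, which is what CJS's `hperm` delivers).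

This module: `StateNr` + its `PieceIn` assembly + `StateIn.toNr` + the initial state
`StateNr.init` for ANY non-zero locally principal `𝔟` (no `IsReduced`) + `StateNr.host_stalk_eq_span_of_joint` (at an N-charged
host point the host stalk is generated by a regular parameter — the exponent-one consequence of (J#)).

## References
* E. Bierstone, D. Grigoriev, P. Milman, J. Włodarczyk, arXiv:1206.3090, Def. 3.1.3, §4 Step 2. [BierstoneGrigorievMilmanWlodarczyk2011]
* V. Cossart, U. Jannsen, S. Saito, LNM 2270 (2020), Thm. 1.4, Def. 3.1, Def. 4.1, (6.2). [CossartJannsenSaito2020]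
* J. Kollár, *Lectures on Resolution of Singularities* (2007), 3.30.2, (3.111) Step 1. [Kollar2007]
-/

-- `Summit.<Summit>.<Sub>.Theorems` with `Sub = Summit` (single-conjunct summit, D-0017)
set_option linter.dupNamespace false

noncomputable section

open CategoryTheory CategoryTheory.Limits AlgebraicGeometry TopologicalSpace IsLocalRing
open Literature.AlgebraicGeometry.Resolution Scheme.IdealSheafData

namespace Summit.ResolutionOfSingularities.ResolutionOfSingularities.Theorems

universe u

namespace WeightTwoB

open DepthSNC

variable {W : Scheme.{u}}

/-- [OURS · L1 W5.2] **The transport state of T5-E^nr** on the current (regular) scheme: `WeightTwoB.StateIn` without the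
reduced-host clause `hostRad` (see the module docstring). [cite: BierstoneGrigorievMilmanWlodarczyk2011, Def. 3.1.3]
[cite: Kollar2007, 3.30.2] -/
structure StateNr [IsLocallyNoetherian W] (𝔟 D : W.IdealSheafData) (ℬ 𝒟 : List (W.IdealSheafData × ℕ)) : Prop where
  /-- the ambient scheme is regular -/
  regW : Scheme.IsRegular W
  /-- the factorisation host · boundary monomial -/
  fac : 𝔟 = D * monomialIdeal ℬ
  /-- the host is an effective Cartier divisor (NOT necessarily reduced) -/
  hostCartier : IsEffectiveCartier D
  /-- the boundary sheaves have simple normal crossings -/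
  sncB : HasSNC (boundaryOf ℬ)
  /-- the boundary sheaves have irreducible supports -/
  irred : ∀ p ∈ ℬ, IsIrreducible (p.1.support : Set W)
  /-- no boundary sheaf has its support inside the host (the host has no boundary component) -/
  free : ∀ p ∈ ℬ, ¬ ((p.1.support : Set W) ⊆ D.support)
  /-- the N-exponent list lives on boundary sheaves -/
  sub𝒟 : ∀ p ∈ 𝒟, p.1 ∈ boundaryOf ℬ
  /-- (J#): at host points on an N-charged member, host and charged members are snc -/
  joint : ∀ x ∈ D.support, (∃ p ∈ 𝒟, 0 < p.2 ∧ x ∈ p.1.support) → SNCWithAt (D :: charged ℬ 𝒟) ⊤ x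

/-- Forgetting reducedness: res-D-pv-054's reduced state is a state of T5-E^nr. [folklore] -/
theorem StateIn.toNr [IsLocallyNoetherian W] {𝔟 D : W.IdealSheafData} {ℬ 𝒟 : List (W.IdealSheafData × ℕ)}
    (S : StateIn 𝔟 D ℬ 𝒟) : StateNr 𝔟 D ℬ 𝒟 where
  regW := S.regW
  fac := S.fac
  hostCartier := S.hostCartier
  sncB := S.sncB
  irred := S.irred
  free := S.free
  sub𝒟 := S.sub𝒟
  joint := S.joint

namespace StateNr

variable [IsLocallyNoetherian W] {𝔟 D : W.IdealSheafData} {ℬ 𝒟 : List (W.IdealSheafData × ℕ)} (S : StateNr 𝔟 D ℬ 𝒟)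
include S

/-- **State + centre data + generic point = the single-piece datum** of `…DepthWeightTwoBPieceStep` (reducedness-free).
[folklore] -/
theorem pieceIn {Z : Closeds W} (Γ : CentreIn D ℬ Z) {η : W} (hη : IsGenericPoint η (Z : Set W)) :
    PieceIn 𝔟 D ℬ 𝒟 Z η where
  regW := S.regW
  fac := S.fac
  hostCartier := S.hostCartier
  sncB := S.sncB
  sub𝒟 := S.sub𝒟
  joint := S.joint
  gen := hη
  regZ := Γ.regZ
  subZ := Γ.subZ
  sncZ := Γ.sncZ
  perm := fun _ => Γ.perm

/-- **(J#) forces exponent one**: at a host point lying on an N-charged member, the host stalk is generated by ONE member of a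
regular system of parameters — in particular by an element outside `𝔪²`; a component of the host passing through such a point
has multiplicity one in `D` (plan-1's invariant «components of exponent `≥ 2` never meet N-charged members», STEER 4 (3)).
[cite: Kollar2007, 3.104 Step 2.1] -/
theorem host_stalk_eq_span_of_joint {x : W} (hx : x ∈ D.support) (hN : ∃ p ∈ 𝒟, 0 < p.2 ∧ x ∈ p.1.support) :
    ∃ h : W.presheaf.stalk x, stalkIdeal D x = Ideal.span {h} ∧ h ∈ maximalIdeal (W.presheaf.stalk x) ∧
      h ∉ maximalIdeal (W.presheaf.stalk x) ^ 2 :=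
  exists_generator_not_mem_sq_of_sncWithAt (S.joint x hx hN) (List.mem_cons_self) hx

end StateNr

/-! ## The initial state (no reducedness) -/

/-- **The initial state** `(𝔟, D = 𝔟, [], [])` for ANY non-zero locally principal `𝔟` on a regular scheme — T5-E^nr drops
`IsReduced 𝔟.subscheme`. [cite: CossartJannsenSaito2020, Thm. 1.4] -/
theorem StateNr.init [IsIntegral W] [IsLocallyNoetherian W] (hW : Scheme.IsRegular W) {𝔟 : W.IdealSheafData} (h𝔟 : 𝔟 ≠ ⊥)
    (hlp : IsLocallyPrincipal 𝔟) : StateNr 𝔟 𝔟 [] [] where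
  regW := hW
  fac := by rw [monomialIdeal_nil, Scheme.IdealSheafData.mul_top]
  hostCartier := hlp.isEffectiveCartier_of_ne_bot h𝔟
  sncB := by
    simpa [boundaryOf] using hasSNCWith_nil_of_isRegular hW (isRegular_subscheme_top (X := W))
  irred := fun p hp => by simp at hp
  free := fun p hp => by simp at hp
  sub𝒟 := fun p hp => by simp at hp
  joint := fun x _ h => by obtain ⟨p, hp, -⟩ := h; simp at hp

end WeightTwoB

end Summit.ResolutionOfSingularities.ResolutionOfSingularities.Theorems

end
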